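import Mathlib
import HarnessLib
import Literature.MathematicalPhysics.QuantumLattice.GrassmannIntegral
import Literature.MathematicalPhysics.QuantumLattice.GrassmannLaplacianPairWick
import Summits.HubbardSuperconductivity.HubbardSuperconductivity.Theorems.KLProgrammeKLRegimeVolumeLimitSixPointFourier
import Summits.HubbardSuperconductivity.HubbardSuperconductivity.Theorems.KLProgrammeKLRegimeVolumeLimitSixPointDefs

/-!
# Child `KLRegimeVolumeLimitV12` (stmt-HubbardSuperconductivity-19858), stub `stub_vl_bound` — the six-point insertion of the finite-`M`
# Schwinger–Dyson form as the Fourier coefficient of the LANE'S SIX-POINT WORD `sixPointWord` (k3c5-p1, `…VolumeLimitSixPointDefs`),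
# and its label-uniform majorant (seat hubbard-kl-k3c5-p3, technique «OS-positivity-free direct assembly»)

`…VolumeLimitSixPointFourier` wrote `βL²·b(k,↑)` (`b = ∫e^{−V}(∂⁺_{k↑}W)(∂⁻_{k↑}W)`) as a grid-time Fourier coefficient of
`∫e^{−V}·J(z,u)·J̄(0,0)` (annihilation-type current at `(z,u)`).  The lane's interface for the `M → ∞` half (k3c5-p1's `sixPointWord L M β σ τ z s =
J̄_{z,s}·J_{0,0}`, barred current at `(z,s)`) is the mirror placement; this module proves the identity DIRECTLY in that convention:

  `βL² · ∫dμ_C e^{−V}(∂⁺_{k↑}W)(∂⁻_{k↑}W) = +(β/N) · Σ_{j<N} Σ_z e^{−iω_k u_j} conj χ_{k⃗}(z) · ∫dμ_C e^{−V} · sixPointWord L M β 0 1 z u_j`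

(`sixPoint_up_eq_fourier_word`; `u_j = jβ/N`, any `N > 4M`, `β ≠ 0`, every `U`, `L`, `M`), hence
`‖∫e^{−V}(∂⁺_{k↑}W)(∂⁻_{k↑}W)‖ ≤ max_{j,z} ‖∫e^{−V}·sixPointWord L M β 0 1 z u_j‖` for EVERY label `k` (`norm_sixPoint_up_le_of_wordBound`).
So an `M`-eventual bound on the normalised six-point word, uniform on the torus × time grid, IS an `M`-eventual label-uniform bound on the
current–current term of the VL carrier — the finite-`M` (U)-step of `stub_vl_bound` in the ∃-threshold form, for every coupling.
Ingredients: the six-point selection rule and orthogonality lemmas of `…SixPointSelection`, `sixPointWord_eq_currents`, generator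
anticommutation.  Everything is proved; no definition.
-/

noncomputable section

namespace Summit.HubbardSuperconductivity.HubbardSuperconductivity.Theorems.TwoPointAssembly

set_option linter.dupNamespace false -- summit = problem name (single-conjunct summit), D-0017

open Finset Filter Topology Literature.MathematicalPhysics.QuantumLattice Literature.Probability.LatticeModels GrassmannAlgebra
open Summit.HubbardSuperconductivity.HubbardSuperconductivity.Theorems.KLRegimeSplit
open Summit.HubbardSuperconductivity.HubbardSuperconductivity.Theorems.KLProgrammeLegKernels
open scoped ComplexConjugate

variable {L M : ℕ} [NeZero L]

/-! ## §1 The barred current at `(z,u)` and the current at the origin, expanded; the word in current form -/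

/-- **`J̄(z,u) = ψ⁺_↑ψ⁺_↓ψ⁻_↓ (z,u)` expanded** over label triples `q = (k₁, k₃', k₄')`. -/
theorem currentBar_up_eq_sum (β : ℝ) (z : TorusSite 2 L) (u : ℝ) :
    positionField L M β 0 0 z u * (positionField L M β 0 1 z u * positionField L M β 1 1 z u) =
      ∑ q : FreqMomentum L M × FreqMomentum L M × FreqMomentum L M,
        ((((1 / (β * (L : ℝ) ^ 2) : ℝ) : ℂ) * conj (vertexPlaneWave L M β 0 q.1 z u)) *
            ((((1 / (β * (L : ℝ) ^ 2) : ℝ) : ℂ) * conj (vertexPlaneWave L M β 0 q.2.1 z u)) *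
              (((1 / (β * (L : ℝ) ^ 2) : ℝ) : ℂ) * conj (vertexPlaneWave L M β 1 q.2.2 z u)))) •
          (psiPlus q.1 0 * (psiPlus q.2.1 1 * psiMinus q.2.2 1)) := by
  rw [positionField, positionField, positionField]
  simp_rw [Finset.sum_mul, Finset.mul_sum, smul_mul_smul_comm]
  conv_rhs => rw [Fintype.sum_prod_type]
  refine Finset.sum_congr rfl fun k₁ _ => ?_
  conv_rhs => rw [Fintype.sum_prod_type]
  rfl

/-- **`J(0,0) = ψ⁻_↑ψ⁺_↓ψ⁻_↓ (0,0)` expanded**: all leg phases are `1`. -/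
theorem current_up_origin_eq_sum (β : ℝ) :
    positionField L M β 1 0 0 0 * (positionField L M β 0 1 0 0 * positionField L M β 1 1 0 0) =
      ∑ p : FreqMomentum L M × FreqMomentum L M × FreqMomentum L M,
        (((1 / (β * (L : ℝ) ^ 2)) ^ 3 : ℝ) : ℂ) • (psiMinus p.1 0 * (psiPlus p.2.1 1 * psiMinus p.2.2 1)) := by
  rw [positionField, positionField, positionField]
  simp only [vertexPlaneWave_origin, map_one, mul_one]
  simp_rw [Finset.sum_mul, Finset.mul_sum, smul_mul_smul_comm]
  conv_rhs => rw [Fintype.sum_prod_type]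
  refine Finset.sum_congr rfl fun k₁ _ => ?_
  conv_rhs => rw [Fintype.sum_prod_type]
  refine Finset.sum_congr rfl fun k₃ _ => Finset.sum_congr rfl fun k₄ _ => ?_
  congr 1
  push_cast
  ring

/-- The lane's six-point word at spins `(↑,↓)` in current form with the lone `ψ⁻_↑` moved to the front of `J(0,0)`:
`sixPointWord β 0 1 z u = J̄(z,u) · (ψ⁻_↑(ψ⁺_↓ψ⁻_↓))(0,0)`. -/
theorem sixPointWord_up_eq_currents' (β : ℝ) (z : TorusSite 2 L) (u : ℝ) :
    sixPointWord L M β 0 1 z u =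
      (positionField L M β 0 0 z u * (positionField L M β 0 1 z u * positionField L M β 1 1 z u)) *
        (positionField L M β 1 0 0 0 * (positionField L M β 0 1 0 0 * positionField L M β 1 1 0 0)) := by
  rw [sixPointWord_eq_currents]
  have h2 : ((1 : ZMod 2) + 1) = 0 := by decide
  have h0 : positionField L M β 0 1 0 0 * positionField L M β 1 1 0 0 ∈ evenOdd ℂ 0 := by
    have h := SetLike.mul_mem_graded (positionField_mem_evenOdd_one (L := L) (M := M) β 0 1 0 0)
      (positionField_mem_evenOdd_one (L := L) (M := M) β 1 1 0 0)
    rwa [h2] at h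
  rw [(commute_of_mem_evenOdd_zero ℂ h0 (positionField L M β 1 0 0 0)).eq]

omit [NeZero L] in
/-- Two cubic monomials whose inner pairs are even anticommute:
`(ψ_d (ψ_e ψ_f)) · (ψ_a (ψ_b ψ_c)) = −(ψ_a (ψ_b ψ_c)) · (ψ_d (ψ_e ψ_f))`. -/
theorem cubic_mul_cubic_eq_neg (a b c d e f : HubbardFieldIdx L M) :
    gen ℂ d * (gen ℂ e * gen ℂ f) * (gen ℂ a * (gen ℂ b * gen ℂ c)) =
      -(gen ℂ a * (gen ℂ b * gen ℂ c) * (gen ℂ d * (gen ℂ e * gen ℂ f))) := by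
  set P : HubbardGrassmann L M := gen ℂ b * gen ℂ c with hP
  set P' : HubbardGrassmann L M := gen ℂ e * gen ℂ f with hP'
  have hPe : P ∈ evenOdd ℂ 0 := gen_mul_gen_mem_evenOdd_zero ℂ b c
  have hP'e : P' ∈ evenOdd ℂ 0 := gen_mul_gen_mem_evenOdd_zero ℂ e f
  have h1 : P' * gen ℂ a = gen ℂ a * P' := (commute_of_mem_evenOdd_zero ℂ hP'e (gen ℂ a)).eq
  have h2 : P * gen ℂ d = gen ℂ d * P := (commute_of_mem_evenOdd_zero ℂ hPe (gen ℂ d)).eq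
  have h3 : P * P' = P' * P := (commute_of_mem_evenOdd_zero ℂ hPe P').eq
  have h4 : gen ℂ d * gen ℂ a = -(gen ℂ a * gen ℂ d) := gen_mul_gen ℂ d a
  calc gen ℂ d * P' * (gen ℂ a * P) = gen ℂ d * (P' * gen ℂ a) * P := by noncomm_ring
    _ = gen ℂ d * (gen ℂ a * P') * P := by rw [h1]
    _ = (gen ℂ d * gen ℂ a) * (P' * P) := by noncomm_ring
    _ = -(gen ℂ a * gen ℂ d) * (P' * P) := by rw [h4]
    _ = -((gen ℂ a * gen ℂ d) * (P * P')) := by rw [h3]; noncomm_ring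
    _ = -(gen ℂ a * (gen ℂ d * P) * P') := by noncomm_ring
    _ = -(gen ℂ a * (P * gen ℂ d) * P') := by rw [h2]
    _ = -(gen ℂ a * P * (gen ℂ d * P')) := by noncomm_ring

/-! ## §2 Orthogonality of the conjugate leg phases against the barred current -/

omit [NeZero L] in
/-- The four time phases of `e^{−iω_k u}·J̄`-legs combine to the integer transfer `m = n₁ − n_k + n₃' − n₄'`. -/
theorem timePhases_bar_eq_exp_transfer (β : ℝ) (k k₁ k₃ k₄ : FreqMomentum L M) (u : ℝ) :
    Complex.exp (-(((matsubaraFreq β M k.1 * u : ℝ) : ℂ) * Complex.I)) *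
        (Complex.exp (((matsubaraFreq β M k₁.1 * u : ℝ) : ℂ) * Complex.I) *
          (Complex.exp (((matsubaraFreq β M k₃.1 * u : ℝ) : ℂ) * Complex.I) *
            Complex.exp (-(((matsubaraFreq β M k₄.1 * u : ℝ) : ℂ) * Complex.I)))) =
      Complex.exp (((2 * Real.pi *
          ((matsubaraInt M k₁.1 - matsubaraInt M k.1 + matsubaraInt M k₃.1 - matsubaraInt M k₄.1 : ℤ) : ℝ) * u / β : ℝ) : ℂ) *
        Complex.I) := by
  rw [← Complex.exp_add, ← Complex.exp_add, ← Complex.exp_add]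
  congr 1
  simp only [matsubaraFreq]
  push_cast
  field_simp
  ring

/-- The four torus characters combine: `conj χ_k(z) χ_{k₁}(z) χ_{k₃}(z) conj χ_{k₄}(z) = χ_{k₁ − k + k₃ − k₄}(z)`. -/
theorem torusChars_bar_eq_torusChar_transfer (k k₁ k₃ k₄ z : TorusSite 2 L) :
    conj (torusChar k z) * (torusChar k₁ z * (torusChar k₃ z * conj (torusChar k₄ z))) = torusChar (k₁ - k + k₃ - k₄) z := by
  rw [torusChar_sub_left, torusChar_comm (k₁ - k + k₃), torusChar_add_right, torusChar_comm z, torusChar_comm z,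
    torusChar_sub_left]
  ring

/-- **The phase sum of one `J̄`-triple against `e^{−iω_k u_j} conj χ_{k⃗}(z)`** (`β ≠ 0`, `4M < N`):
`Σ_j Σ_z e^{−iω_k u_j} conj χ_k(z) a⁰_{k₁}a⁰_{k₃'}a¹_{k₄'}(z,u_j) = (βL²)⁻³ · N[n₁+n₃' = n_k+n₄'] · L²[k⃗₁+k⃗₃' = k⃗+k⃗₄']`. -/
theorem sum_sum_phases_currentBar_up {β : ℝ} (hβ : β ≠ 0) {N : ℕ} (hN : 4 * M < N) (k k₁ k₃ k₄ : FreqMomentum L M) :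
    ∑ j : Fin N, ∑ z : TorusSite 2 L,
        Complex.exp (-(((matsubaraFreq β M k.1 * gridTime β N j : ℝ) : ℂ) * Complex.I)) * conj (torusChar k.2 z) *
          ((((1 / (β * (L : ℝ) ^ 2) : ℝ) : ℂ) * conj (vertexPlaneWave L M β 0 k₁ z (gridTime β N j))) *
            ((((1 / (β * (L : ℝ) ^ 2) : ℝ) : ℂ) * conj (vertexPlaneWave L M β 0 k₃ z (gridTime β N j))) *
              (((1 / (β * (L : ℝ) ^ 2) : ℝ) : ℂ) * conj (vertexPlaneWave L M β 1 k₄ z (gridTime β N j))))) =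
      (((1 / (β * (L : ℝ) ^ 2)) ^ 3 : ℝ) : ℂ) *
        ((if matsubaraInt M k₁.1 + matsubaraInt M k₃.1 = matsubaraInt M k.1 + matsubaraInt M k₄.1 then (N : ℂ) else 0) *
          (if k₁.2 + k₃.2 = k.2 + k₄.2 then ((L : ℂ) ^ 2) else 0)) := by
  have hterm : ∀ (j : Fin N) (z : TorusSite 2 L),
      Complex.exp (-(((matsubaraFreq β M k.1 * gridTime β N j : ℝ) : ℂ) * Complex.I)) * conj (torusChar k.2 z) *
          ((((1 / (β * (L : ℝ) ^ 2) : ℝ) : ℂ) * conj (vertexPlaneWave L M β 0 k₁ z (gridTime β N j))) *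
            ((((1 / (β * (L : ℝ) ^ 2) : ℝ) : ℂ) * conj (vertexPlaneWave L M β 0 k₃ z (gridTime β N j))) *
              (((1 / (β * (L : ℝ) ^ 2) : ℝ) : ℂ) * conj (vertexPlaneWave L M β 1 k₄ z (gridTime β N j))))) =
        (((1 / (β * (L : ℝ) ^ 2)) ^ 3 : ℝ) : ℂ) *
          (Complex.exp (((2 * Real.pi *
              ((matsubaraInt M k₁.1 - matsubaraInt M k.1 + matsubaraInt M k₃.1 - matsubaraInt M k₄.1 : ℤ) : ℝ) *
                gridTime β N j / β : ℝ) : ℂ) * Complex.I) *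
            torusChar (k₁.2 - k.2 + k₃.2 - k₄.2) z) := by
    intro j z
    rw [← timePhases_bar_eq_exp_transfer β k k₁ k₃ k₄, ← torusChars_bar_eq_torusChar_transfer, conj_vertexPlaneWave_zero_eq,
      conj_vertexPlaneWave_zero_eq, conj_vertexPlaneWave_one_eq]
    push_cast
    ring
  simp_rw [hterm]
  rw [Finset.sum_comm]
  simp_rw [← Finset.mul_sum, ← Finset.sum_mul]
  rw [← Finset.mul_sum]
  have hm : (matsubaraInt M k₁.1 - matsubaraInt M k.1 + matsubaraInt M k₃.1 - matsubaraInt M k₄.1).natAbs < N := by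
    have h1 := k.1.isLt; have h2 := k₁.1.isLt; have h3 := k₃.1.isLt; have h4 := k₄.1.isLt
    simp only [matsubaraInt]
    omega
  rw [sum_exp_freqTransfer_gridTime hβ hm, sum_torusChar_right]
  have hfreq : (matsubaraInt M k₁.1 - matsubaraInt M k.1 + matsubaraInt M k₃.1 - matsubaraInt M k₄.1 = 0) ↔
      matsubaraInt M k₁.1 + matsubaraInt M k₃.1 = matsubaraInt M k.1 + matsubaraInt M k₄.1 := by omega
  have hmom : (k₁.2 - k.2 + k₃.2 - k₄.2 = 0) ↔ k₁.2 + k₃.2 = k.2 + k₄.2 := by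
    constructor
    · intro h; linear_combination h
    · intro h; linear_combination h
  simp only [hfreq, hmom]

/-! ## §3 The Fourier form against the lane's six-point word, and the label-uniform majorant -/

/-- **The word six-point function expanded over label triples**:
`∫e^{−V}·sixPointWord β 0 1 z u = Σ_{q,p} (ā_q(z,u)·(βL²)⁻³)·(−∫e^{−V} m⁺_p m⁻_q)`. -/
theorem wordSixPoint_up_eq_sum (β U μ : ℝ) (z : TorusSite 2 L) (u : ℝ) :
    gaussExpect ℂ (hubbardCovariance L M β μ 0) (grassmannExp (-(hubbardInteraction L M β U)) * sixPointWord L M β 0 1 z u) =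
      ∑ q : FreqMomentum L M × FreqMomentum L M × FreqMomentum L M,
        ∑ p : FreqMomentum L M × FreqMomentum L M × FreqMomentum L M,
          ((((1 / (β * (L : ℝ) ^ 2) : ℝ) : ℂ) * conj (vertexPlaneWave L M β 0 q.1 z u)) *
              ((((1 / (β * (L : ℝ) ^ 2) : ℝ) : ℂ) * conj (vertexPlaneWave L M β 0 q.2.1 z u)) *
                (((1 / (β * (L : ℝ) ^ 2) : ℝ) : ℂ) * conj (vertexPlaneWave L M β 1 q.2.2 z u))) *
            (((1 / (β * (L : ℝ) ^ 2)) ^ 3 : ℝ) : ℂ)) *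
          -gaussExpect ℂ (hubbardCovariance L M β μ 0)
            (grassmannExp (-(hubbardInteraction L M β U)) *
              (psiMinus p.1 0 * (psiPlus p.2.1 1 * psiMinus p.2.2 1) * (psiPlus q.1 0 * (psiPlus q.2.1 1 * psiMinus q.2.2 1)))) := by
  rw [sixPointWord_up_eq_currents', currentBar_up_eq_sum, current_up_origin_eq_sum, Finset.sum_mul_sum, Finset.mul_sum, map_sum]
  refine Finset.sum_congr rfl fun q _ => ?_
  rw [Finset.mul_sum, map_sum]
  refine Finset.sum_congr rfl fun p _ => ?_
  rw [smul_mul_smul_comm, mul_smul_comm, map_smul, smul_eq_mul, psiPlus, psiPlus, psiMinus, psiMinus, psiPlus, psiMinus,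
    cubic_mul_cubic_eq_neg, mul_neg, map_neg]

/-- **THE FOURIER FORM AGAINST THE LANE'S WORD** (`β ≠ 0`, every `U`, every finite `(L, M)`, `N > 4M`, `u_j = jβ/N`):
`βL² · ∫e^{−V}(∂⁺_{k↑}W)(∂⁻_{k↑}W) = (β/N) · Σ_{j<N} Σ_z e^{−iω_k u_j} conj χ_{k⃗}(z) · ∫e^{−V}·sixPointWord L M β 0 1 z u_j`. -/
theorem sixPoint_up_eq_fourier_word {β : ℝ} (hβ : β ≠ 0) (U μ : ℝ) {N : ℕ} (hN : 4 * M < N) (k : FreqMomentum L M) :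
    ((β * (L : ℝ) ^ 2 : ℝ) : ℂ) *
        gaussExpect ℂ (hubbardCovariance L M β μ 0)
          (grassmannExp (-(hubbardInteraction L M β U)) *
            (grassmannDeriv ℂ (((k, 0), 0) : HubbardFieldIdx L M) (hubbardInteraction L M β 1) *
              grassmannDeriv ℂ (((k, 0), 1) : HubbardFieldIdx L M) (hubbardInteraction L M β 1))) =
      ((β / N : ℝ) : ℂ) *
        ∑ j : Fin N, ∑ z : TorusSite 2 L,
          Complex.exp (-(((matsubaraFreq β M k.1 * gridTime β N j : ℝ) : ℂ) * Complex.I)) * conj (torusChar k.2 z) *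
            gaussExpect ℂ (hubbardCovariance L M β μ 0)
              (grassmannExp (-(hubbardInteraction L M β U)) * sixPointWord L M β 0 1 z (gridTime β N j)) := by
  have hN0 : (N : ℂ) ≠ 0 := by
    have : 0 < N := lt_of_le_of_lt (Nat.zero_le _) hN
    exact_mod_cast this.ne'
  set r : ℂ := (((1 / (β * (L : ℝ) ^ 2) ^ 3 : ℝ) : ℂ)) with hr
  set r' : ℂ := (((1 / (β * (L : ℝ) ^ 2)) ^ 3 : ℝ) : ℂ) with hr'
  have hrr : r' = r := by rw [hr, hr']; push_cast; ring
  set G : (FreqMomentum L M × FreqMomentum L M × FreqMomentum L M) → (FreqMomentum L M × FreqMomentum L M × FreqMomentum L M) → ℂ :=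
    fun p q => gaussExpect ℂ (hubbardCovariance L M β μ 0)
      (grassmannExp (-(hubbardInteraction L M β U)) *
        (psiMinus p.1 0 * (psiPlus p.2.1 1 * psiMinus p.2.2 1) * (psiPlus q.1 0 * (psiPlus q.2.1 1 * psiMinus q.2.2 1)))) with hG
  rw [sixPoint_up_eq_sum]
  simp_rw [wordSixPoint_up_eq_sum]
  have key : (∑ j : Fin N, ∑ z : TorusSite 2 L,
      Complex.exp (-(((matsubaraFreq β M k.1 * gridTime β N j : ℝ) : ℂ) * Complex.I)) * conj (torusChar k.2 z) *
        ∑ q : FreqMomentum L M × FreqMomentum L M × FreqMomentum L M,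
          ∑ p : FreqMomentum L M × FreqMomentum L M × FreqMomentum L M,
            ((((1 / (β * (L : ℝ) ^ 2) : ℝ) : ℂ) * conj (vertexPlaneWave L M β 0 q.1 z (gridTime β N j))) *
                ((((1 / (β * (L : ℝ) ^ 2) : ℝ) : ℂ) * conj (vertexPlaneWave L M β 0 q.2.1 z (gridTime β N j))) *
                  (((1 / (β * (L : ℝ) ^ 2) : ℝ) : ℂ) * conj (vertexPlaneWave L M β 1 q.2.2 z (gridTime β N j)))) *
              r') * -G p q) =
      ∑ q : FreqMomentum L M × FreqMomentum L M × FreqMomentum L M,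
        ∑ p : FreqMomentum L M × FreqMomentum L M × FreqMomentum L M,
          (r' * ((if matsubaraInt M q.1.1 + matsubaraInt M q.2.1.1 = matsubaraInt M k.1 + matsubaraInt M q.2.2.1 then (N : ℂ) else 0) *
            (if q.1.2 + q.2.1.2 = k.2 + q.2.2.2 then ((L : ℂ) ^ 2) else 0))) * (r' * -G p q) := by
    simp_rw [Finset.mul_sum]
    rw [sum_sum_sum_sum_comm]
    refine Finset.sum_congr rfl fun q _ => Finset.sum_congr rfl fun p _ => ?_
    rw [← sum_sum_phases_currentBar_up hβ hN k q.1 q.2.1 q.2.2, Finset.sum_mul]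
    refine Finset.sum_congr rfl fun j _ => ?_
    rw [Finset.sum_mul]
    refine Finset.sum_congr rfl fun z _ => ?_
    ring
  rw [key, hrr, Finset.sum_comm]
  simp_rw [Finset.mul_sum]
  refine Finset.sum_congr rfl fun q _ => Finset.sum_congr rfl fun p _ => ?_
  by_cases hcq : matsubaraInt M q.1.1 + matsubaraInt M q.2.1.1 = matsubaraInt M k.1 + matsubaraInt M q.2.2.1 ∧
      q.1.2 + q.2.1.2 = k.2 + q.2.2.2
  · rw [if_pos hcq.1, if_pos hcq.2]
    by_cases hcp : matsubaraInt M k.1 + matsubaraInt M p.2.1.1 = matsubaraInt M p.1.1 + matsubaraInt M p.2.2.1 ∧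
        k.2 + p.2.1.2 = p.1.2 + p.2.2.2
    · rw [if_pos hcp, if_pos hcq]
      simp only [hG, hr]
      push_cast
      field_simp
    · -- the origin current violates the selection rule
      have hsel : G p q = 0 := by
        rw [hG]
        refine gaussExpect_boltzmann_sixMonomial_up_eq_zero β U μ fun hcomp => hcp ⟨?_, ?_⟩
        · have h1 := hcomp.1; have h2 := hcq.1; omega
        · linear_combination hcomp.2 - hcq.2
      rw [if_neg hcp, hsel]
      ring
  · have h0 : (if matsubaraInt M q.1.1 + matsubaraInt M q.2.1.1 = matsubaraInt M k.1 + matsubaraInt M q.2.2.1 then (N : ℂ) else 0) *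
        (if q.1.2 + q.2.1.2 = k.2 + q.2.2.2 then ((L : ℂ) ^ 2) else 0) = 0 := by
      rcases not_and_or.mp hcq with h | h
      · rw [if_neg h, zero_mul]
      · rw [if_neg h, mul_zero]
    rw [h0]
    split_ifs <;> ring

/-- **THE LABEL-UNIFORM MAJORANT AGAINST THE LANE'S WORD** (`β ≠ 0`, `N > 4M`): a bound `B` on the word six-point function on the torus × time
grid, `‖∫e^{−V}·sixPointWord L M β 0 1 z u_j‖ ≤ B`, bounds the current–current insertion at EVERY label: `‖∫e^{−V}(∂⁺_{k↑}W)(∂⁻_{k↑}W)‖ ≤ B`. -/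
theorem norm_sixPoint_up_le_of_wordBound {β : ℝ} (hβ : β ≠ 0) (U μ : ℝ) {N : ℕ} (hN : 4 * M < N) (k : FreqMomentum L M) {B : ℝ}
    (hB : ∀ (j : Fin N) (z : TorusSite 2 L),
      ‖gaussExpect ℂ (hubbardCovariance L M β μ 0)
          (grassmannExp (-(hubbardInteraction L M β U)) * sixPointWord L M β 0 1 z (gridTime β N j))‖ ≤ B) :
    ‖gaussExpect ℂ (hubbardCovariance L M β μ 0)
        (grassmannExp (-(hubbardInteraction L M β U)) *
          (grassmannDeriv ℂ (((k, 0), 0) : HubbardFieldIdx L M) (hubbardInteraction L M β 1) *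
            grassmannDeriv ℂ (((k, 0), 1) : HubbardFieldIdx L M) (hubbardInteraction L M β 1)))‖ ≤ B := by
  have hN0 : 0 < N := lt_of_le_of_lt (Nat.zero_le _) hN
  have hL : (0 : ℝ) < (L : ℝ) := by exact_mod_cast Nat.pos_of_ne_zero (NeZero.ne L)
  have hc : 0 < |β| * (L : ℝ) ^ 2 := by positivity
  have h := congrArg norm (sixPoint_up_eq_fourier_word hβ U μ hN k)
  rw [norm_mul, norm_mul, Complex.norm_real, Complex.norm_real, Real.norm_eq_abs, Real.norm_eq_abs, abs_mul, abs_pow,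
    Nat.abs_cast, abs_div, Nat.abs_cast] at h
  have hsum : ‖∑ j : Fin N, ∑ z : TorusSite 2 L,
      Complex.exp (-(((matsubaraFreq β M k.1 * gridTime β N j : ℝ) : ℂ) * Complex.I)) * conj (torusChar k.2 z) *
        gaussExpect ℂ (hubbardCovariance L M β μ 0)
          (grassmannExp (-(hubbardInteraction L M β U)) * sixPointWord L M β 0 1 z (gridTime β N j))‖ ≤
      (N : ℝ) * ((L : ℝ) ^ 2 * B) := by
    refine (norm_sum_le _ _).trans ?_
    calc _ ≤ ∑ _j : Fin N, (L : ℝ) ^ 2 * B := Finset.sum_le_sum fun j _ => ?_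
      _ = (N : ℝ) * ((L : ℝ) ^ 2 * B) := by rw [Finset.sum_const, Finset.card_univ, Fintype.card_fin, nsmul_eq_mul]
    refine (norm_sum_le _ _).trans ?_
    calc _ ≤ ∑ _z : TorusSite 2 L, B := Finset.sum_le_sum fun z _ => ?_
      _ = (L : ℝ) ^ 2 * B := by
          rw [Finset.sum_const, Finset.card_univ, nsmul_eq_mul]
          congr 1
          rw [Fintype.card_fun, Fintype.card_fin, ZMod.card, Nat.cast_pow]
    rw [norm_mul, norm_mul, ← neg_mul, ← Complex.ofReal_neg, Complex.norm_exp_ofReal_mul_I, Complex.norm_conj, norm_torusChar,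
      one_mul, one_mul]
    exact hB j z
  have hle : |β| * (L : ℝ) ^ 2 * ‖gaussExpect ℂ (hubbardCovariance L M β μ 0)
      (grassmannExp (-(hubbardInteraction L M β U)) *
        (grassmannDeriv ℂ (((k, 0), 0) : HubbardFieldIdx L M) (hubbardInteraction L M β 1) *
          grassmannDeriv ℂ (((k, 0), 1) : HubbardFieldIdx L M) (hubbardInteraction L M β 1)))‖ ≤ |β| * (L : ℝ) ^ 2 * B := by
    rw [h]
    calc |β| / (N : ℝ) * _ ≤ |β| / (N : ℝ) * ((N : ℝ) * ((L : ℝ) ^ 2 * B)) :=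
          mul_le_mul_of_nonneg_left hsum (by positivity)
      _ = |β| * (L : ℝ) ^ 2 * B := by
          have hN' : (N : ℝ) ≠ 0 := by exact_mod_cast hN0.ne'
          field_simp
  exact le_of_mul_le_mul_left hle hc

end Summit.HubbardSuperconductivity.HubbardSuperconductivity.Theorems.TwoPointAssembly

end
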